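import Literature.AlgebraicTopology.SingularHomology.Hurewicz
import Literature.AlgebraicTopology.SingularHomology.HurewiczOne
import Literature.AlgebraicTopology.SingularHomology.RelativeCapProduct
import Literature.AlgebraicTopology.SingularHomology.SimplyConnectedH1
import Mathlib.Analysis.Convex.Contractible
import HarnessLib

/-!
# The Hurewicz theorem in degree one — proof of the named fact `hurewicz_one`

Sibling proof file of `Hurewicz.lean` (D-0014: the named fact
`Literature.AlgebraicTopology.SingularHomology.singularHomology.hurewicz_one`, Hatcher, *Algebraic Topology* (2002), Thm. 2A.1, is
discharged here as `Literature.AlgebraicTopology.SingularHomology.singularHomology.hurewicz_one_holds`). `HurewiczOne.lean` constructs the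
Hurewicz homomorphism `Literature.hurewiczOne R M m x : π₁(X, x) →* H₁(X; M)` ("loops as singular
`1`-cycles": well defined, multiplicative, natural) and its factorisation `Literature.AlgebraicTopology.SingularHomology.hurewiczOneAb`
through the abelianisation, explicitly leaving open the theorem that `h` induces
`π₁(X, x)ᵃᵇ ≅ H₁(X; ℤ)`. This file proves that theorem, following Hatcher's printed proof
(pp. 166–167), for `ℤ` coefficients and a path-connected `X`:

* `Literature.AlgebraicTopology.SingularHomology.HurewiczProof.hurewiczOneAb_injective`, `Literature.AlgebraicTopology.SingularHomology.HurewiczProof.ker_hurewiczOne`: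
  **`ker h = [π₁, π₁]`**. Choose paths `λ_y` from `x₀` to every `y` (`lam`); to a singular
  `1`-simplex `σ` attach the based loop `λ_{σe₀} σ λ_{σe₁}⁻¹` (`based`) and its class
  `[based σ]ᵃᵇ ∈ π₁ᵃᵇ` (`gen`); extended additively to `1`-chains (`psi`), this kills the
  boundary of every singular `2`-simplex (`gen_face`, from the **cocycle relation**
  `basedClass_face_one`: the faces of `τ : Δ² → X` are the images of the edges of `Δ²`, and
  `[e₀,e₁]·[e₁,e₂] ≃ [e₀,e₂]` in the simply connected `Δ²`), hence descends to
  `ψ̄ : H₁(X; ℤ) → π₁ᵃᵇ` (`psiH`, via `Literature.AlgebraicTopology.SingularHomology.homologyDesc'`) with `ψ̄ (h γ) = [γ]ᵃᵇ`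
  (`psiH_loopClass`: `[λ γ λ⁻¹]ᵃᵇ = [γ]ᵃᵇ`), so `ψ̄ ∘ h̄ = id`.
* `Literature.AlgebraicTopology.SingularHomology.HurewiczProof.hurewiczOneAb_surjective`, `Literature.AlgebraicTopology.SingularHomology.HurewiczProof.hurewiczOne_surjective`:
  **`h` is onto**. For a `1`-simplex `σ`, `λ σ λ⁻¹ ∼ λ_{σe₀} + σ - λ_{σe₁}` modulo boundaries,
  with the explicit `2`-chain `eChain σ` (`d_eChain`; built from the `2`-simplices of
  concatenations `ofTrans`, the constant `2`-simplex and the `2`-chain of the homotopy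
  `refl ≃ λ λ⁻¹` of `HurewiczOne.lean`); additively, `Φ = id + ∂ ∘ E - L ∘ ∂` on `1`-chains
  (`phiMap_eq`), where `Φ` substitutes based loops for simplices and `L` cones `0`-chains to the
  base point; so a cycle `z` is homologous to `Φ z` (`phiMap_cycle`), whose class is
  `h̄ (ψ z)` (`hPsi_eq`).
* `Literature.singularHomology.hurewicz_one_holds : singularHomology.hurewicz_one` — with
  `h = hurewiczOne ℤ ℤ 1 x₀`.

Auxiliary material (all proved, `[folklore]`): end points `src`/`tgt` of a singular `1`-simplex
`σ` and the faces `face_zero_eq`/`face_one_eq` (over `σ.toPath` of `SimplyConnectedH1.lean`),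
the edges of `Δ²` as paths (`edge01`, `edge12`, `edge02`) and the contractibility of the
standard simplices (`Literature.AlgebraicTopology.SingularHomology.StdSimplex.contractibleSpace_stdSimplex`),
additive maps out of Mathlib's singular chains prescribed on elementary chains (`extendSingle`,
`addMonoidHom_ext_single`, through the comparison `csingularChainComplex.compIso` with concrete
chains), and `homologyCls_zsmul`.

## References

* A. Hatcher, *Algebraic Topology*, Cambridge University Press (2002), §2.A, Thm. 2A.1,
  pp. 166–167 (held copy PDF pp. 215–216) [HatcherAT2002].

## Design notes

* Everything is over `ℤ` with the unit coefficient `m = 1`, as in the named fact. Integer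
  multiples are the `SubNegMonoid` action (`zsmul`) throughout, and the maps on chains are
  additive maps (`→+`) rather than `ℤ`-linear maps, which sidesteps the (propositionally but not
  definitionally unique) `Module ℤ` structures on the `ModuleCat` objects; `homologyCls_zsmul`
  bridges to the homology classes of `ChainSubcomplex.lean`.
* As in `SingularChainsConcrete.lean` / `HurewiczOne.lean`, the identification of Mathlib's
  singular chain modules with concrete finitely supported chains holds up to unfolding of
  semireducible definitions, whence `backward.isDefEq.respectTransparency false`.
* No declaration in this file uses `sorry`.
-/

noncomputable section

-- see the implementation notes of `SingularChainsConcrete.lean`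
set_option backward.isDefEq.respectTransparency false

open CategoryTheory Set

universe u

namespace Literature.AlgebraicTopology.SingularHomology

namespace HurewiczProof

open SingularSimplex singularChainComplex StdSimplex

variable {X : Type u} [TopologicalSpace X]

/-! ### Singular `1`-simplices as paths -/

/-- The starting point `σ(e₀)` of a singular `1`-simplex (the source of `σ.toPath`). [folklore] -/
abbrev src (σ : SingularSimplex X 1) : X := toContinuousMap σ (ofUnitInterval 0)

/-- The end point `σ(e₁)` of a singular `1`-simplex (the target of `σ.toPath`). [folklore] -/
abbrev tgt (σ : SingularSimplex X 1) : X := toContinuousMap σ (ofUnitInterval 1)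

/-- Value of the path `σ.toPath` of a singular `1`-simplex (`SimplyConnectedH1.lean`; Hatcher,
§2.A: "a map `f : I → X` can be viewed as either a path or a singular `1`-simplex"). [folklore] -/
lemma toPath_apply (σ : SingularSimplex X 1) (t : unitInterval) :
    σ.toPath t = toContinuousMap σ (ofUnitInterval t) := rfl

/-- `(ofPath γ).toPath` is `γ` (pointwise). [folklore] -/
lemma toPath_ofPath_apply {x y : X} (γ : Path x y) (t : unitInterval) :
    (ofPath γ).toPath t = γ t := by
  rw [toPath_apply, ofPath_apply, toUnitInterval_ofUnitInterval]

/-- The faces of a singular `1`-simplex are its end points: `σ ∘ δ₀ = [tgt σ]`. [folklore] -/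
lemma face_zero_eq (σ : SingularSimplex X 1) : σ.face 0 = ofPoint (tgt σ) := by
  conv_lhs => rw [← ofPath_toPath σ]
  rw [ofPath_face_zero]

/-- The faces of a singular `1`-simplex are its end points: `σ ∘ δ₁ = [src σ]`. [folklore] -/
lemma face_one_eq (σ : SingularSimplex X 1) : σ.face 1 = ofPoint (src σ) := by
  conv_lhs => rw [← ofPath_toPath σ]
  rw [ofPath_face_one]

/-! ### Based loops -/

variable [PathConnectedSpace X] (x₀ : X)

/-- A chosen path `λ_y` from the base point `x₀` to `y` (Hatcher, proof of Thm. 2A.1).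
[folklore] -/
def lam (y : X) : Path x₀ y := PathConnectedSpace.somePath x₀ y

/-- The **based loop** `λ_a · γ · λ_b⁻¹` at `x₀` of a path `γ` from `a` to `b` (Hatcher, proof of
Thm. 2A.1, surjectivity step). [cite: HatcherAT2002, Thm. 2A.1] -/
def basedP {a b : X} (γ : Path a b) : Path x₀ x₀ :=
  (lam x₀ a).trans (γ.trans (lam x₀ b).symm)

/-- `basedP` only depends on the underlying function of the path. [folklore] -/
lemma basedP_congr {a b a' b' : X} {γ : Path a b} {γ' : Path a' b'} (h : ∀ t, γ t = γ' t) :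
    basedP x₀ γ = basedP x₀ γ' := by
  obtain rfl : a = a' := by simpa using h 0
  obtain rfl : b = b' := by simpa using h 1
  obtain rfl : γ = γ' := Path.ext (funext h)
  rfl

/-- The based loop `λ_{σ e₀} · σ · λ_{σ e₁}⁻¹` of a singular `1`-simplex. [folklore] -/
def based (σ : SingularSimplex X 1) : Path x₀ x₀ := basedP x₀ σ.toPath

/-- The based loop of the `1`-simplex of a path. [folklore] -/
lemma based_ofPath {a b : X} (γ : Path a b) : based x₀ (ofPath γ) = basedP x₀ γ :=
  basedP_congr x₀ (toPath_ofPath_apply γ)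

/-- The class `[based σ] ∈ π₁(X, x₀)`. [folklore] -/
def basedClass (σ : SingularSimplex X 1) : FundamentalGroup X x₀ :=
  FundamentalGroup.fromPath (Path.Homotopic.Quotient.mk (based x₀ σ))

/-- In `π₁(X, x₀)`: for a loop `γ` at `x₀`, `[λ · γ · λ⁻¹] = [λ] [γ] [λ]⁻¹` is conjugate to `[γ]`,
hence has the same image in the abelianisation. [folklore] -/
lemma abelianizationOf_basedClass_ofPath (γ : Path x₀ x₀) :
    Abelianization.of (basedClass x₀ (ofPath γ)) =
      Abelianization.of (FundamentalGroup.fromPath (Path.Homotopic.Quotient.mk γ)) := by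
  rw [basedClass, based_ofPath, basedP]
  set c : FundamentalGroup X x₀ := FundamentalGroup.fromPath (Path.Homotopic.Quotient.mk (lam x₀ x₀))
  set g : FundamentalGroup X x₀ := FundamentalGroup.fromPath (Path.Homotopic.Quotient.mk γ)
  have : FundamentalGroup.fromPath (Path.Homotopic.Quotient.mk
      ((lam x₀ x₀).trans (γ.trans (lam x₀ x₀).symm))) = c⁻¹ * g * c := by
    rw [Path.Homotopic.Quotient.mk_trans, Path.Homotopic.Quotient.mk_trans,
      Path.Homotopic.Quotient.mk_symm, FundamentalGroup.mul_def, FundamentalGroup.mul_def,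
      FundamentalGroup.inv_def]
  rw [this, map_mul, map_mul, map_inv, mul_comm (Abelianization.of c)⁻¹, mul_assoc,
    inv_mul_cancel, mul_one]

omit [PathConnectedSpace X] in
/-- Cancellation of a path against its reverse inside a concatenation:
`γ⁻¹ · (γ · δ) ≃ δ`. [folklore] -/
lemma symm_trans_trans_homotopic {a b c : X} (γ : Path a b) (δ : Path b c) :
    (γ.symm.trans (γ.trans δ)).Homotopic δ :=
  Path.Homotopic.trans (Path.Homotopic.symm ⟨Path.Homotopy.transAssoc γ.symm γ δ⟩)
    (Path.Homotopic.trans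
      (Path.Homotopic.hcomp (Path.Homotopic.symm ⟨Path.Homotopy.reflSymmTrans γ⟩)
        (Path.Homotopic.refl δ))
      ⟨Path.Homotopy.reflTrans δ⟩)

/-- `basedP` is compatible with concatenation up to homotopy:
`(λ_a α λ_b⁻¹) · (λ_b β λ_c⁻¹) ≃ λ_a (α · β) λ_c⁻¹` (Hatcher, proof of Thm. 2A.1). [folklore] -/
lemma basedP_trans {a b c : X} (α : Path a b) (β : Path b c) :
    Path.Homotopic.Quotient.mk ((basedP x₀ α).trans (basedP x₀ β)) =
      Path.Homotopic.Quotient.mk (basedP x₀ (α.trans β)) := by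
  apply Quotient.sound
  -- `(A (α Bs)) (B (β Cs)) ≃ A ((α Bs) (B (β Cs))) ≃ A (α (Bs (B (β Cs)))) ≃ A (α (β Cs)) ≃ A ((α β) Cs)`
  refine Path.Homotopic.trans ⟨Path.Homotopy.transAssoc _ _ _⟩
    (Path.Homotopic.hcomp (Path.Homotopic.refl _) ?_)
  refine Path.Homotopic.trans ⟨Path.Homotopy.transAssoc _ _ _⟩ ?_
  refine Path.Homotopic.trans
    (Path.Homotopic.hcomp (Path.Homotopic.refl α) (symm_trans_trans_homotopic _ _)) ?_
  exact Path.Homotopic.symm ⟨Path.Homotopy.transAssoc _ _ _⟩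

/-- `basedP` respects homotopy of paths. [folklore] -/
lemma basedP_eq_of_homotopic {a b : X} {α α' : Path a b} (h : α.Homotopic α') :
    Path.Homotopic.Quotient.mk (basedP x₀ α) = Path.Homotopic.Quotient.mk (basedP x₀ α') := by
  simp only [basedP, Path.Homotopic.Quotient.mk_trans, Path.Homotopic.Quotient.mk_symm,
    Path.Homotopic.Quotient.eq.mpr h]

/-! ### The cocycle relation on a singular `2`-simplex -/

/-- The standard simplex `Δⁿ` is contractible (it is convex and nonempty); in particular it is
simply connected. [folklore] -/
instance _root_.Literature.AlgebraicTopology.SingularHomology.StdSimplex.contractibleSpace_stdSimplex (n : ℕ) : ContractibleSpace (StdSimplex n) :=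
  (convex_stdSimplex ℝ (Fin (n + 1))).contractibleSpace ⟨_, (stdSimplex.vertex 0).2⟩

/-- Extensionality for points of `Δ²` through the three coordinates. [folklore] -/
lemma stdSimplex_two_ext {s t : StdSimplex 2} (h0 : (s : Fin 3 → ℝ) 0 = (t : Fin 3 → ℝ) 0)
    (h1 : (s : Fin 3 → ℝ) 1 = (t : Fin 3 → ℝ) 1) (h2 : (s : Fin 3 → ℝ) 2 = (t : Fin 3 → ℝ) 2) :
    s = t := by
  apply Subtype.ext
  funext j
  fin_cases j
  · exact h0
  · exact h1
  · exact h2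

/-- The edge `[e₀, e₁]` of `Δ²`, parametrised as the face `δ₂`: `t ↦ (1 - t, t, 0)`. [folklore] -/
def edge01 : Path (stdSimplex.vertex (S := ℝ) (0 : Fin 3)) (stdSimplex.vertex (S := ℝ) (1 : Fin 3)) where
  toFun t := stdSimplex.map (Fin.succAbove (2 : Fin 3)) (ofUnitInterval t)
  continuous_toFun := (stdSimplex.continuous_map _).comp continuous_ofUnitInterval
  source' := by
    apply stdSimplex_two_ext
    · rw [map_succAbove_two_apply_zero, ofUnitInterval_apply_zero]; simp [stdSimplex.vertex]
    · rw [map_succAbove_two_apply_one, ofUnitInterval_apply_one]; simp [stdSimplex.vertex]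
    · rw [map_succAbove_two_apply_two]; simp [stdSimplex.vertex]
  target' := by
    apply stdSimplex_two_ext
    · rw [map_succAbove_two_apply_zero, ofUnitInterval_apply_zero]; simp [stdSimplex.vertex]
    · rw [map_succAbove_two_apply_one, ofUnitInterval_apply_one]; simp [stdSimplex.vertex]
    · rw [map_succAbove_two_apply_two]; simp [stdSimplex.vertex]

/-- The edge `[e₁, e₂]` of `Δ²`, parametrised as the face `δ₀`: `t ↦ (0, 1 - t, t)`. [folklore] -/
def edge12 : Path (stdSimplex.vertex (S := ℝ) (1 : Fin 3)) (stdSimplex.vertex (S := ℝ) (2 : Fin 3)) where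
  toFun t := stdSimplex.map (Fin.succAbove (0 : Fin 3)) (ofUnitInterval t)
  continuous_toFun := (stdSimplex.continuous_map _).comp continuous_ofUnitInterval
  source' := by
    apply stdSimplex_two_ext
    · rw [map_succAbove_zero_apply_zero]; simp [stdSimplex.vertex]
    · rw [map_succAbove_zero_apply_one, ofUnitInterval_apply_zero]; simp [stdSimplex.vertex]
    · rw [map_succAbove_zero_apply_two, ofUnitInterval_apply_one]; simp [stdSimplex.vertex]
  target' := by
    apply stdSimplex_two_ext
    · rw [map_succAbove_zero_apply_zero]; simp [stdSimplex.vertex]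
    · rw [map_succAbove_zero_apply_one, ofUnitInterval_apply_zero]; simp [stdSimplex.vertex]
    · rw [map_succAbove_zero_apply_two, ofUnitInterval_apply_one]; simp [stdSimplex.vertex]

/-- The edge `[e₀, e₂]` of `Δ²`, parametrised as the face `δ₁`: `t ↦ (1 - t, 0, t)`. [folklore] -/
def edge02 : Path (stdSimplex.vertex (S := ℝ) (0 : Fin 3)) (stdSimplex.vertex (S := ℝ) (2 : Fin 3)) where
  toFun t := stdSimplex.map (Fin.succAbove (1 : Fin 3)) (ofUnitInterval t)
  continuous_toFun := (stdSimplex.continuous_map _).comp continuous_ofUnitInterval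
  source' := by
    apply stdSimplex_two_ext
    · rw [map_succAbove_one_apply_zero, ofUnitInterval_apply_zero]; simp [stdSimplex.vertex]
    · rw [map_succAbove_apply_self]; simp [stdSimplex.vertex]
    · rw [map_succAbove_one_apply_two, ofUnitInterval_apply_one]; simp [stdSimplex.vertex]
  target' := by
    apply stdSimplex_two_ext
    · rw [map_succAbove_one_apply_zero, ofUnitInterval_apply_zero]; simp [stdSimplex.vertex]
    · rw [map_succAbove_apply_self]; simp [stdSimplex.vertex]
    · rw [map_succAbove_one_apply_two, ofUnitInterval_apply_one]; simp [stdSimplex.vertex]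

/-- In `Δ²`, `[e₀, e₁] · [e₁, e₂] ≃ [e₀, e₂]` (`Δ²` is simply connected). [folklore] -/
lemma edge01_trans_edge12 : (edge01.trans edge12).Homotopic edge02 :=
  SimplyConnectedSpace.paths_homotopic _ _

omit [PathConnectedSpace X] in
/-- The faces of a singular `2`-simplex `τ`, as paths, are the images under `τ` of the edges of
`Δ²`: face `2` is `τ ∘ [e₀, e₁]`. [folklore] -/
lemma toPath_face_two_apply (τ : SingularSimplex X 2) (t : unitInterval) :
    (τ.face 2).toPath t = (edge01.map (toContinuousMap τ).continuous) t := by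
  rw [toPath_apply, toContinuousMap_face]
  rfl

omit [PathConnectedSpace X] in
/-- Face `0` of `τ` is `τ ∘ [e₁, e₂]`. [folklore] -/
lemma toPath_face_zero_apply (τ : SingularSimplex X 2) (t : unitInterval) :
    (τ.face 0).toPath t = (edge12.map (toContinuousMap τ).continuous) t := by
  rw [toPath_apply, toContinuousMap_face]
  rfl

omit [PathConnectedSpace X] in
/-- Face `1` of `τ` is `τ ∘ [e₀, e₂]`. [folklore] -/
lemma toPath_face_one_apply (τ : SingularSimplex X 2) (t : unitInterval) :
    (τ.face 1).toPath t = (edge02.map (toContinuousMap τ).continuous) t := by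
  rw [toPath_apply, toContinuousMap_face]
  rfl

/-- **The cocycle relation** (Hatcher, proof of Thm. 2A.1, the step "`∂` of a singular
`2`-simplex goes to zero"): for a singular `2`-simplex `τ` with faces `f₀ = τ∘[e₁,e₂]`,
`f₁ = τ∘[e₀,e₂]`, `f₂ = τ∘[e₀,e₁]`, the based loops satisfy `[based f₂] · [based f₀] = [based f₁]`
in `π₁(X, x₀)`, because `[e₀,e₁]·[e₁,e₂] ≃ [e₀,e₂]` in `Δ²`. In Mathlib's `FundamentalGroup`
(`mul_def : p * q = q.trans p`) this reads `basedClass f₁ = basedClass f₀ * basedClass f₂`.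
[cite: HatcherAT2002, Thm. 2A.1] -/
lemma basedClass_face_one (τ : SingularSimplex X 2) :
    basedClass x₀ (τ.face 1) = basedClass x₀ (τ.face 0) * basedClass x₀ (τ.face 2) := by
  have h2 : based x₀ (τ.face 2) = basedP x₀ (edge01.map (toContinuousMap τ).continuous) :=
    basedP_congr x₀ (toPath_face_two_apply τ)
  have h0 : based x₀ (τ.face 0) = basedP x₀ (edge12.map (toContinuousMap τ).continuous) :=
    basedP_congr x₀ (toPath_face_zero_apply τ)
  have h1 : based x₀ (τ.face 1) = basedP x₀ (edge02.map (toContinuousMap τ).continuous) :=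
    basedP_congr x₀ (toPath_face_one_apply τ)
  rw [basedClass, basedClass, basedClass, FundamentalGroup.mul_def, h0, h1, h2,
    ← Path.Homotopic.Quotient.mk_trans, basedP_trans, ← Path.map_trans]
  exact congrArg _ (basedP_eq_of_homotopic x₀
    (edge01_trans_edge12.map (toContinuousMap τ)).symm)

/-! ### The inverse `ψ : H₁(X; ℤ) → π₁(X, x₀)ᵃᵇ` of the Hurewicz homomorphism -/

/-- The abelianised fundamental group, written additively (a `ℤ`-module). [folklore] -/
abbrev PiAb : Type u := Additive (Abelianization (FundamentalGroup X x₀))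

/-- The generator `[based σ]ᵃᵇ ∈ π₁(X, x₀)ᵃᵇ` attached to a singular `1`-simplex `σ`
(Hatcher, proof of Thm. 2A.1: "the homomorphism `C₁(X) → π₁(X)ᵃᵇ` sending `σ` to the class of
`λ_{σ e₀} σ λ_{σ e₁}⁻¹`"). [cite: HatcherAT2002, Thm. 2A.1] -/
def gen (σ : SingularSimplex X 1) : PiAb x₀ :=
  Additive.ofMul (Abelianization.of (basedClass x₀ σ))

/-- Hatcher's homomorphism `ψ : C₁(X; ℤ) → π₁(X, x₀)ᵃᵇ`, `∑ kᵢ σᵢ ↦ ∑ kᵢ [based σᵢ]ᵃᵇ`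
(proof of Thm. 2A.1), on Mathlib's singular `1`-chains through the comparison with concrete
chains. [cite: HatcherAT2002, Thm. 2A.1] -/
def psi : ((singularChainComplex ℤ ℤ X).X 1) →ₗ[ℤ] PiAb x₀ :=
  (Finsupp.lsum ℤ fun σ => LinearMap.toSpanSingleton ℤ (PiAb x₀) (gen x₀ σ)) ∘ₗ
    ((csingularChainComplex.compIso ℤ ℤ X).inv.f 1).hom

/-- `ψ (k σ) = k [based σ]ᵃᵇ`. [folklore] -/
@[simp] lemma psi_single (σ : SingularSimplex X 1) (k : ℤ) :
    psi x₀ (single (R := ℤ) σ k) = k • gen x₀ σ := by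
  rw [psi, LinearMap.comp_apply]
  change (Finsupp.lsum ℤ fun σ => LinearMap.toSpanSingleton ℤ (PiAb x₀) (gen x₀ σ))
    ((csingularChainComplex.compIso ℤ ℤ X).inv.f 1 (single (R := ℤ) σ k)) = _
  rw [csingularChainComplex.compIso_inv_f_single]
  simp

/-- The cocycle relation in `π₁(X, x₀)ᵃᵇ`: `[based f₀]ᵃᵇ - [based f₁]ᵃᵇ + [based f₂]ᵃᵇ = 0` for
the faces of a singular `2`-simplex (`basedClass_face_one`). [folklore] -/
lemma gen_face (τ : SingularSimplex X 2) :
    gen x₀ (τ.face 0) - gen x₀ (τ.face 1) + gen x₀ (τ.face 2) = 0 := by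
  rw [gen, gen, gen, basedClass_face_one, map_mul, ofMul_mul]
  abel

/-- **`ψ` vanishes on boundaries** (Hatcher, proof of Thm. 2A.1). [cite: HatcherAT2002, Thm. 2A.1] -/
lemma psi_comp_d : psi x₀ ∘ₗ ((singularChainComplex ℤ ℤ X).d 2 1).hom = 0 := by
  have h : ModuleCat.ofHom (psi x₀ ∘ₗ ((singularChainComplex ℤ ℤ X).d 2 1).hom) =
      (ModuleCat.ofHom (0 : (singularChainComplex ℤ ℤ X).X 2 →ₗ[ℤ] PiAb x₀) :
        (singularChainComplex ℤ ℤ X).X 2 ⟶ ModuleCat.of ℤ (PiAb x₀)) := by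
    refine singularChainComplex.hom_ext fun τ k => ?_
    change psi x₀ ((singularChainComplex ℤ ℤ X).d 2 1 (single (R := ℤ) τ k)) = 0
    rw [d_single_two, map_add, map_sub, psi_single, psi_single, psi_single, ← smul_sub,
      ← smul_add, gen_face, smul_zero]
  exact congrArg ModuleCat.Hom.hom h

/-- Hatcher's `ψ` on homology: `ψ̄ : H₁(X; ℤ) → π₁(X, x₀)ᵃᵇ`, `[∑ kᵢ σᵢ] ↦ ∑ kᵢ [based σᵢ]ᵃᵇ`.
[cite: HatcherAT2002, Thm. 2A.1] -/
def psiH : singularHomology ℤ ℤ X 1 →ₗ[ℤ] PiAb x₀ :=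
  homologyDesc' 2 (ChainComplex.prev ℕ 1) (psi x₀) (psi_comp_d x₀)

/-- `ψ̄ (h γ) = [γ]ᵃᵇ`: on the Hurewicz class of a loop `γ` at `x₀`, `ψ̄` gives back the class of
`γ` (`[λ γ λ⁻¹]ᵃᵇ = [γ]ᵃᵇ`). [cite: HatcherAT2002, Thm. 2A.1] -/
lemma psiH_loopClass (γ : Path x₀ x₀) :
    psiH x₀ (loopClass ℤ ℤ (1 : ℤ) γ) =
      Additive.ofMul (Abelianization.of (FundamentalGroup.fromPath (Path.Homotopic.Quotient.mk γ))) := by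
  rw [psiH, loopClass, homologyDesc'_cls, psi_single, one_smul, gen,
    abelianizationOf_basedClass_ofPath]

/-- **`ψ̄ ∘ h̄ = id` on `π₁(X, x₀)ᵃᵇ`** (Hatcher, proof of Thm. 2A.1, injectivity of `h̄`).
[cite: HatcherAT2002, Thm. 2A.1] -/
lemma psiH_hurewiczOneAb (g : Abelianization (FundamentalGroup X x₀)) :
    psiH x₀ (Multiplicative.toAdd (hurewiczOneAb ℤ ℤ (1 : ℤ) x₀ g)) = Additive.ofMul g := by
  obtain ⟨p, rfl⟩ := QuotientGroup.mk_surjective g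
  induction p using Quotient.ind with
  | _ γ =>
    change psiH x₀ (Multiplicative.toAdd (hurewiczOneAb ℤ ℤ (1 : ℤ) x₀
      (Abelianization.of (FundamentalGroup.fromPath (Path.Homotopic.Quotient.mk γ))))) =
        Additive.ofMul (Abelianization.of (FundamentalGroup.fromPath (Path.Homotopic.Quotient.mk γ)))
    rw [hurewiczOneAb_of_fromPath, toAdd_ofAdd, psiH_loopClass]

/-- **The Hurewicz homomorphism on `π₁ᵃᵇ` is injective** (Hatcher, Thm. 2A.1).
[cite: HatcherAT2002, Thm. 2A.1] -/
theorem hurewiczOneAb_injective : Function.Injective (hurewiczOneAb ℤ ℤ (1 : ℤ) x₀) := by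
  intro g₁ g₂ h
  have h' := congrArg (fun y => psiH x₀ (Multiplicative.toAdd y)) h
  simp only [psiH_hurewiczOneAb] at h'
  exact Additive.ofMul.injective h'

/-- **The kernel of the Hurewicz homomorphism is the commutator subgroup** (Hatcher, Thm. 2A.1).
[cite: HatcherAT2002, Thm. 2A.1] -/
theorem ker_hurewiczOne : (hurewiczOne ℤ ℤ (1 : ℤ) x₀).ker = commutator (FundamentalGroup X x₀) := by
  have hcomp : hurewiczOne ℤ ℤ (1 : ℤ) x₀ = (hurewiczOneAb ℤ ℤ (1 : ℤ) x₀).comp Abelianization.of := by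
    ext p
    rfl
  rw [hcomp, ← MonoidHom.comap_ker, (MonoidHom.ker_eq_bot_iff _).mpr (hurewiczOneAb_injective x₀),
    MonoidHom.comap_bot, Abelianization.ker_of]

/-! ### Surjectivity: every `1`-cycle is homologous to a sum of based loops -/

omit [PathConnectedSpace X] in
/-- An elementary chain is the integer multiple of the unit elementary chain. [folklore] -/
lemma single_eq_zsmul {n : ℕ} (σ : SingularSimplex X n) (k : ℤ) :
    single (R := ℤ) σ k = k • single (R := ℤ) σ (1 : ℤ) := by
  rw [← singleₗ_apply, ← singleₗ_apply, ← map_zsmul (singleₗ (R := ℤ) σ) k (1 : ℤ), zsmul_one,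
    Int.cast_id]

/-- Hatcher's `2`-chain witnessing `λ_a σ λ_b⁻¹ ∼ λ_a + σ - λ_b` for a singular `1`-simplex `σ`
from `a` to `b` (proof of Thm. 2A.1, facts (i)–(iv): reparametrisation, inverses and
concatenation of paths up to boundaries): with `p = λ_a`, `q = σ`, `r = λ_b`,
`E σ = [r, r⁻¹] + κ - H - [q, r⁻¹] - [p, q r⁻¹]`, where `[u, v]` is the `2`-simplex of a
concatenation (`ofTrans`), `κ` the constant `2`-simplex and `H` the `2`-chain of the homotopy
`refl ≃ r r⁻¹`. [cite: HatcherAT2002, Thm. 2A.1] -/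
def eChain (σ : SingularSimplex X 1) : (singularChainComplex ℤ ℤ X).X 2 :=
  single (R := ℤ) (ofTrans (lam x₀ (tgt σ)) (lam x₀ (tgt σ)).symm) 1 +
    single (R := ℤ) (const₂ x₀) 1 -
    homotopyChain ℤ ℤ (1 : ℤ) (Path.Homotopy.reflTransSymm (lam x₀ (tgt σ))) -
    single (R := ℤ) (ofTrans σ.toPath (lam x₀ (tgt σ)).symm) 1 -
    single (R := ℤ) (ofTrans (lam x₀ (src σ)) (σ.toPath.trans (lam x₀ (tgt σ)).symm)) 1

/-- **`∂ E σ = λ_b - σ + (λ_a σ λ_b⁻¹) - λ_a`** (Hatcher, proof of Thm. 2A.1).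
[cite: HatcherAT2002, Thm. 2A.1] -/
lemma d_eChain (σ : SingularSimplex X 1) :
    (singularChainComplex ℤ ℤ X).d 2 1 (eChain x₀ σ) =
      single (R := ℤ) (ofPath (lam x₀ (tgt σ))) 1 - single (R := ℤ) σ 1 +
        single (R := ℤ) (ofPath (based x₀ σ)) 1 - single (R := ℤ) (ofPath (lam x₀ (src σ))) 1 := by
  rw [eChain, map_sub, map_sub, map_sub, map_add, d_single_ofTrans, d_single_ofTrans,
    d_single_ofTrans, d_single_const₂, d_homotopyChain, ofPath_toPath]
  change _ = _ - _ + single (R := ℤ) (ofPath ((lam x₀ (src σ)).trans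
    (σ.toPath.trans (lam x₀ (tgt σ)).symm))) 1 - _
  abel

omit [PathConnectedSpace X] in
/-- Additive maps out of Mathlib's singular `n`-chains with `ℤ` coefficients, prescribed on the
elementary chains: `∑ kᵢ σᵢ ↦ ∑ kᵢ • v σᵢ` (through the comparison with concrete chains).
[folklore] -/
def extendSingle {n : ℕ} {N : Type*} [AddCommGroup N] (v : SingularSimplex X n → N) :
    ((singularChainComplex ℤ ℤ X).X n) →+ N :=
  (Finsupp.liftAddHom fun σ => zmultiplesHom N (v σ)).comp
    ((csingularChainComplex.compIso ℤ ℤ X).inv.f n).hom.toAddMonoidHom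

omit [PathConnectedSpace X] in
/-- `extendSingle v (k σ) = k • v σ`. [folklore] -/
@[simp] lemma extendSingle_single {n : ℕ} {N : Type*} [AddCommGroup N]
    (v : SingularSimplex X n → N) (σ : SingularSimplex X n) (k : ℤ) :
    extendSingle v (single (R := ℤ) σ k) = k • v σ := by
  rw [extendSingle, AddMonoidHom.comp_apply]
  change (Finsupp.liftAddHom fun σ => zmultiplesHom N (v σ))
    ((csingularChainComplex.compIso ℤ ℤ X).inv.f n (single (R := ℤ) σ k)) = _
  rw [csingularChainComplex.compIso_inv_f_single, Finsupp.liftAddHom_apply_single, zmultiplesHom_apply]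

omit [PathConnectedSpace X] in
/-- Every singular chain of Mathlib's model is the image of a concrete (finitely supported)
chain. [folklore] -/
lemma exists_compIso_hom_eq {n : ℕ} (c : (singularChainComplex ℤ ℤ X).X n) :
    ∃ c' : CChain ℤ X n, (csingularChainComplex.compIso ℤ ℤ X).hom.f n c' = c := by
  refine ⟨(csingularChainComplex.compIso ℤ ℤ X).inv.f n c, ?_⟩
  have h := congrArg (fun φ => φ.f n c) (csingularChainComplex.compIso ℤ ℤ X).inv_hom_id
  simpa only [HomologicalComplex.comp_f, ModuleCat.comp_apply, HomologicalComplex.id_f,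
    ModuleCat.id_apply] using h

omit [PathConnectedSpace X] in
/-- Two additive maps out of the singular `n`-chains agreeing on elementary chains are equal
(`Cₙ(X; ℤ)` is generated by the elementary chains). [folklore] -/
lemma addMonoidHom_ext_single {n : ℕ} {N : Type*} [AddCommGroup N]
    {f g : ((singularChainComplex ℤ ℤ X).X n) →+ N}
    (h : ∀ (σ : SingularSimplex X n) (k : ℤ), f (single (R := ℤ) σ k) = g (single (R := ℤ) σ k)) :
    f = g := by
  have hc : f.comp ((csingularChainComplex.compIso ℤ ℤ X).hom.f n).hom.toAddMonoidHom =
      g.comp ((csingularChainComplex.compIso ℤ ℤ X).hom.f n).hom.toAddMonoidHom := by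
    refine Finsupp.addHom_ext fun σ k => ?_
    change f ((csingularChainComplex.compIso ℤ ℤ X).hom.f n (Finsupp.single σ k)) =
      g ((csingularChainComplex.compIso ℤ ℤ X).hom.f n (Finsupp.single σ k))
    rw [csingularChainComplex.compIso_hom_f_single]
    exact h σ k
  ext c
  obtain ⟨c', rfl⟩ := exists_compIso_hom_eq c
  exact congrArg (fun φ : (CChain ℤ X n) →+ N => φ c') hc

/-- The `2`-chain `E` extended additively: `∑ kᵢ σᵢ ↦ ∑ kᵢ E σᵢ`. [folklore] -/
def eMap : ((singularChainComplex ℤ ℤ X).X 1) →+ ((singularChainComplex ℤ ℤ X).X 2) :=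
  extendSingle (eChain x₀)

/-- `eMap (k σ) = k E σ`. [folklore] -/
@[simp] lemma eMap_single (σ : SingularSimplex X 1) (k : ℤ) :
    eMap x₀ (single (R := ℤ) σ k) = k • eChain x₀ σ :=
  extendSingle_single _ σ k

/-- The cone to the base point on `0`-chains: `∑ kᵢ [yᵢ] ↦ ∑ kᵢ λ_{yᵢ}`. [folklore] -/
def lMap : ((singularChainComplex ℤ ℤ X).X 0) →+ ((singularChainComplex ℤ ℤ X).X 1) :=
  extendSingle fun ρ => single (R := ℤ) (ofPath (lam x₀ (SingularSimplex.pt ρ))) (1 : ℤ)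

/-- `lMap (k [y]) = k λ_y`. [folklore] -/
@[simp] lemma lMap_single_ofPoint (y : X) (k : ℤ) :
    lMap x₀ (single (R := ℤ) (ofPoint y) k) = k • single (R := ℤ) (ofPath (lam x₀ y)) (1 : ℤ) := by
  rw [lMap, extendSingle_single, pt_ofPoint]

/-- The based-loop substitution `Φ : ∑ kᵢ σᵢ ↦ ∑ kᵢ (λ σᵢ λ⁻¹)` on `1`-chains. [folklore] -/
def phiMap : ((singularChainComplex ℤ ℤ X).X 1) →+ ((singularChainComplex ℤ ℤ X).X 1) :=
  extendSingle fun σ => single (R := ℤ) (ofPath (based x₀ σ)) (1 : ℤ)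

/-- `Φ (k σ) = k (λ σ λ⁻¹)`. [folklore] -/
@[simp] lemma phiMap_single (σ : SingularSimplex X 1) (k : ℤ) :
    phiMap x₀ (single (R := ℤ) σ k) = k • single (R := ℤ) (ofPath (based x₀ σ)) (1 : ℤ) :=
  extendSingle_single _ σ k

omit [PathConnectedSpace X] in
/-- The boundary of an elementary `1`-chain: `∂ (k σ) = k [σ e₁] - k [σ e₀]`. [folklore] -/
lemma d_single_one (σ : SingularSimplex X 1) (k : ℤ) :
    (singularChainComplex ℤ ℤ X).d 1 0 (single (R := ℤ) σ k) =
      single (R := ℤ) (ofPoint (tgt σ)) k - single (R := ℤ) (ofPoint (src σ)) k := by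
  conv_lhs => rw [← ofPath_toPath σ]
  rw [d_single_ofPath]

/-- **The key identity `Φ = id + ∂ ∘ E - L ∘ ∂` on `1`-chains** (Hatcher, proof of Thm. 2A.1:
`∑ kᵢ λ σᵢ λ⁻¹` is homologous to `∑ kᵢ σᵢ` plus the cone on its boundary).
[cite: HatcherAT2002, Thm. 2A.1] -/
lemma phiMap_eq : phiMap x₀ = AddMonoidHom.id _ +
    ((singularChainComplex ℤ ℤ X).d 2 1).hom.toAddMonoidHom.comp (eMap x₀) -
    (lMap x₀).comp ((singularChainComplex ℤ ℤ X).d 1 0).hom.toAddMonoidHom := by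
  refine addMonoidHom_ext_single fun σ k => ?_
  change phiMap x₀ (single (R := ℤ) σ k) = single (R := ℤ) σ k +
    (singularChainComplex ℤ ℤ X).d 2 1 (eMap x₀ (single (R := ℤ) σ k)) -
      lMap x₀ ((singularChainComplex ℤ ℤ X).d 1 0 (single (R := ℤ) σ k))
  rw [phiMap_single, eMap_single, map_zsmul, d_eChain, d_single_one, map_sub,
    lMap_single_ofPoint, lMap_single_ofPoint, single_eq_zsmul σ k, zsmul_sub, zsmul_add,
    zsmul_sub]
  abel

/-- `Φ` of a cycle is a homologous cycle: `Φ z = z + ∂ (E z)` when `∂ z = 0`. [folklore] -/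
lemma phiMap_cycle (z : (singularChainComplex ℤ ℤ X).X 1)
    (hz : (singularChainComplex ℤ ℤ X).d 1 0 z = 0) :
    phiMap x₀ z = z + (singularChainComplex ℤ ℤ X).d 2 1 (eMap x₀ z) := by
  have h := congrArg (fun f => f z) (phiMap_eq x₀)
  simp only [AddMonoidHom.sub_apply, AddMonoidHom.add_apply, AddMonoidHom.id_apply,
    AddMonoidHom.comp_apply] at h
  rw [h]
  change z + _ - lMap x₀ ((singularChainComplex ℤ ℤ X).d 1 0 z) = _
  rw [hz, map_zero, sub_zero]
  rfl

/-- `Φ` takes values in cycles (its values are combinations of loops). [folklore] -/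
lemma d_phiMap (c : (singularChainComplex ℤ ℤ X).X 1) :
    (singularChainComplex ℤ ℤ X).d 1 ((ComplexShape.down ℕ).next 1) (phiMap x₀ c) = 0 := by
  have h : ((singularChainComplex ℤ ℤ X).d 1
      ((ComplexShape.down ℕ).next 1)).hom.toAddMonoidHom.comp (phiMap x₀) = 0 := by
    refine addMonoidHom_ext_single fun σ k => ?_
    change (singularChainComplex ℤ ℤ X).d 1 ((ComplexShape.down ℕ).next 1)
      (phiMap x₀ (single (R := ℤ) σ k)) = 0
    rw [phiMap_single, map_zsmul, d_single_ofPath_loop, zsmul_zero]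
  exact congrArg (fun f : ((singularChainComplex ℤ ℤ X).X 1) →+ _ => f c) h

omit [PathConnectedSpace X] in
/-- `[k • z] = k • [z]` for integer multiples of `1`-cycles. [folklore] -/
lemma homologyCls_zsmul (k : ℤ) (z : (singularChainComplex ℤ ℤ X).X 1)
    (hz : (singularChainComplex ℤ ℤ X).d 1 ((ComplexShape.down ℕ).next 1) z = 0)
    (h : (singularChainComplex ℤ ℤ X).d 1 ((ComplexShape.down ℕ).next 1) (k • z) = 0) :
    homologyCls (k • z) h = k • homologyCls z hz := by
  have hcyc : ∀ j : ℤ, (singularChainComplex ℤ ℤ X).d 1 ((ComplexShape.down ℕ).next 1) (j • z) = 0 :=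
    fun j => by rw [map_zsmul, hz, zsmul_zero]
  suffices H : ∀ j : ℤ, homologyCls (j • z) (hcyc j) = j • homologyCls z hz from H k
  have h0 : (singularChainComplex ℤ ℤ X).d 1 ((ComplexShape.down ℕ).next 1) 0 = 0 := map_zero _
  intro j
  induction j using Int.induction_on with
  | zero =>
    calc homologyCls ((0 : ℤ) • z) (hcyc 0) = homologyCls 0 h0 :=
          homologyCls_congr (zero_zsmul z) _ _
      _ = 0 := homologyCls_zero h0
      _ = (0 : ℤ) • homologyCls z hz := (zero_zsmul _).symm
  | succ i ih =>
    calc homologyCls (((i : ℤ) + 1) • z) (hcyc _)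
          = homologyCls ((i : ℤ) • z + z) (by rw [map_add, hcyc, hz, add_zero]) :=
          homologyCls_congr (by rw [add_zsmul, one_zsmul]) _ _
      _ = homologyCls ((i : ℤ) • z) (hcyc i) + homologyCls z hz := homologyCls_add _ _ _ _ _
      _ = ((i : ℤ) + 1) • homologyCls z hz := by rw [ih, add_zsmul, one_zsmul]
  | pred i ih =>
    calc homologyCls ((-(i : ℤ) - 1) • z) (hcyc _)
          = homologyCls (-(i : ℤ) • z - z) (by rw [map_sub, hcyc, hz, sub_zero]) :=
          homologyCls_congr (by rw [sub_zsmul, one_zsmul, sub_eq_add_neg]) _ _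
      _ = homologyCls (-(i : ℤ) • z) (hcyc _) - homologyCls z hz := homologyCls_sub _ _ _ _ _
      _ = (-(i : ℤ) - 1) • homologyCls z hz := by rw [ih, sub_zsmul, one_zsmul, sub_eq_add_neg]

/-- The chain-level composite `h̄ ∘ ψ : C₁(X; ℤ) → H₁(X; ℤ)`, `∑ kᵢ σᵢ ↦ ∑ kᵢ h(λ σᵢ λ⁻¹)`.
[folklore] -/
def hPsi (c : (singularChainComplex ℤ ℤ X).X 1) : singularHomology ℤ ℤ X 1 :=
  Multiplicative.toAdd (hurewiczOneAb ℤ ℤ (1 : ℤ) x₀ (Additive.toMul (psi x₀ c)))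

/-- `h̄ ∘ ψ` is additive. [folklore] -/
lemma hPsi_add (a b : (singularChainComplex ℤ ℤ X).X 1) :
    hPsi x₀ (a + b) = hPsi x₀ a + hPsi x₀ b := by
  rw [hPsi, hPsi, hPsi, map_add, toMul_add, map_mul, toAdd_mul]

/-- `h̄ ∘ ψ` on an elementary chain: `k σ ↦ k • h(λ σ λ⁻¹) = [Φ (k σ)]`. [folklore] -/
lemma hPsi_single (σ : SingularSimplex X 1) (k : ℤ) :
    hPsi x₀ (single (R := ℤ) σ k) = homologyCls (phiMap x₀ (single (R := ℤ) σ k))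
      (d_phiMap x₀ _) := by
  rw [hPsi, psi_single, gen, toMul_zsmul, toMul_ofMul, map_zpow, toAdd_zpow, basedClass,
    hurewiczOneAb_of_fromPath, toAdd_ofAdd, loopClass,
    homologyCls_congr (phiMap_single x₀ σ k) (d_phiMap x₀ _)
      (by rw [← phiMap_single]; exact d_phiMap x₀ _),
    homologyCls_zsmul k _ (d_single_ofPath_loop ℤ ℤ (1 : ℤ) _)]

/-- **`h̄ (ψ c) = [Φ c]` for every `1`-chain `c`** (by additivity, from the elementary chains).
[folklore] -/
lemma hPsi_eq (c : (singularChainComplex ℤ ℤ X).X 1) :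
    hPsi x₀ c = homologyCls (phiMap x₀ c) (d_phiMap x₀ c) := by
  -- write `c` as the image of a concrete (finitely supported) chain and induct on it
  obtain ⟨c', rfl⟩ := exists_compIso_hom_eq c
  induction c' using Finsupp.induction_linear with
  | zero =>
    have h0 : (singularChainComplex ℤ ℤ X).d 1 ((ComplexShape.down ℕ).next 1) 0 = 0 := map_zero _
    rw [map_zero, hPsi, map_zero, toMul_zero, map_one, toAdd_one, ← homologyCls_zero h0]
    exact homologyCls_congr (map_zero _).symm _ _
  | add a b ha hb =>
    rw [map_add, hPsi_add, ha, hb, ← homologyCls_add _ _ _ _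
      (by rw [map_add, d_phiMap, d_phiMap, add_zero])]
    exact homologyCls_congr (map_add _ _ _).symm _ _
  | single σ k =>
    rw [csingularChainComplex.compIso_hom_f_single, hPsi_single]

/-- **The Hurewicz homomorphism on `π₁ᵃᵇ` is surjective** (Hatcher, Thm. 2A.1): the class of a
`1`-cycle `z` is `[Φ z] = h̄ (ψ z)`. [cite: HatcherAT2002, Thm. 2A.1] -/
theorem hurewiczOneAb_surjective : Function.Surjective (hurewiczOneAb ℤ ℤ (1 : ℤ) x₀) := by
  intro y
  obtain ⟨z, hz, hzy⟩ := homologyCls_surjective (Multiplicative.toAdd y)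
  refine ⟨Additive.toMul (psi x₀ z), ?_⟩
  apply Multiplicative.toAdd.injective
  change hPsi x₀ z = Multiplicative.toAdd y
  rw [hPsi_eq, ← hzy, homologyCls_eq_homologyCls_iff,
    exists_d_prev_eq_iff (i := 2) (ChainComplex.prev ℕ 1)]
  refine ⟨eMap x₀ z, ?_⟩
  rw [phiMap_cycle x₀ z ((d_next_eq_zero_iff (ChainComplex.next_nat_succ 0) z).mp hz),
    add_sub_cancel_left]

/-- **The Hurewicz homomorphism `π₁(X, x₀) → H₁(X; ℤ)` is surjective** for path-connected `X`
(Hatcher, Thm. 2A.1). [cite: HatcherAT2002, Thm. 2A.1] -/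
theorem hurewiczOne_surjective : Function.Surjective (hurewiczOne ℤ ℤ (1 : ℤ) x₀) := by
  intro y
  obtain ⟨g, rfl⟩ := hurewiczOneAb_surjective x₀ y
  obtain ⟨p, rfl⟩ := QuotientGroup.mk_surjective g
  exact ⟨p, rfl⟩

end HurewiczProof

/-! ### The named fact -/

/-- **Hurewicz theorem in degree one** (Hatcher, *Algebraic Topology*, Thm. 2A.1), discharging
the named fact `Literature.AlgebraicTopology.SingularHomology.singularHomology.hurewicz_one`: for a path-connected space `X` and a base
point `x₀`, the Hurewicz homomorphism `h : π₁(X, x₀) → H₁(X; ℤ)` — here the concrete one,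
`Literature.hurewiczOne ℤ ℤ 1 x₀`, "loops as singular `1`-cycles" (`HurewiczOne.lean`) — is surjective
with kernel the commutator subgroup. Proof as printed (Hatcher pp. 166–167): with chosen paths
`λ_y` from `x₀` to every `y`, the assignment `σ ↦ [λ_{σe₀} σ λ_{σe₁}⁻¹]ᵃᵇ` on singular
`1`-simplices kills boundaries of singular `2`-simplices (the edge loop of a `2`-simplex is
null-homotopic, `Δ²` being simply connected), so it defines `ψ̄ : H₁(X; ℤ) → π₁(X, x₀)ᵃᵇ` with
`ψ̄ ∘ h̄ = id` (so `ker h = [π₁, π₁]`); and a `1`-cycle `∑ kᵢ σᵢ` is homologous to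
`∑ kᵢ λ σᵢ λ⁻¹ = h(∏ [λ σᵢ λ⁻¹]^{kᵢ})`, the correction terms `∑ kᵢ (λ_{σᵢe₁} - λ_{σᵢe₀})` being
the cone on `∂ (∑ kᵢ σᵢ) = 0` (so `h` is surjective). [cite: HatcherAT2002, Thm. 2A.1] -/
theorem singularHomology.hurewicz_one_holds : singularHomology.hurewicz_one.{u} :=
  fun _ _ _ x₀ => ⟨hurewiczOne ℤ ℤ (1 : ℤ) x₀, HurewiczProof.hurewiczOne_surjective x₀,
    HurewiczProof.ker_hurewiczOne x₀⟩

end Literature.AlgebraicTopology.SingularHomology
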